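import Summits.Ventures.PercRepro.SixFourT4LargeA

/-!
# PercRepro — C-025 at `(6,4)`, §22.7 IN THE KERNEL: `J₄ > 0` for `g ≥ 15` when every plane trace has `≤ 7` points (p3, gen 8)

mine-2's `MINE2-RLS.md` §22.7: for a rank-`4` set `G ⊆ E` of a simple matroid with `g = |G| ≥ 15` points and every
plane meeting `G` in at most `7` points, `J₄(G) > 0`.  Proof (from `J_four_identity`): two rank-`≤ 3` subsets have
at most `7` points each, so `X = 0` for `g ≥ 15` (`Xcnt_eq_zero`); dropping the nonnegative `bonus` and `lpp` terms,
`J₄ ≥ F(g) − Σ_ρ cost_g(ρ) ≥ F(g) − (g − 22/5)·Σ_ρ D₃(ρ)` (`cost_le`), `D₃(ρ) ≤ (14/5)·t(ρ)` (part A) and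
`Σ_ρ t(ρ) ≤ C(g,3)` (the independent triples are partitioned by the planes they span, `sum_card_indepTriples_le`), so
`J₄ ≥ F(g) − (14/5)(g − 22/5)·C(g,3) =: H(g) > 0` (`H_pos`: `H(15) = 10,756.4`; for `g ≥ 16`, `2^g ≥ g^4` gives
`H(g) ≥ (4/15)·g^4 > 0`).  Main result: `J_four_pos_of_fifteen_le`.
-/

namespace PercRepro.SixFour

open Finset ThmH

variable {α : Type*} [DecidableEq α] {M : Matroid α} [M.Finite] {G : Finset α}

/-! ## `X = 0` for `g ≥ 15` -/

/-- In a rank-`4` set whose plane traces have at most `7` points, every rank-`≤ 3` subset has at most `7` points. -/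
theorem card_le_seven_of_eRk_le_three (hs : Simple M) (hG : G ⊆ gr M) (hr : M.eRk (G : Set α) = 4)
    (hpl : ∀ P ∈ planes M, (P ∩ G).card ≤ 7) {Z : Finset α} (hZ : Z ⊆ G) (h3 : M.eRk (Z : Set α) ≤ 3) :
    Z.card ≤ 7 := by
  by_cases h2 : M.eRk (Z : Set α) ≤ 2
  · by_cases hc : Z.card ≤ 1
    · omega
    · -- `Z` spans a line `L`; a point of `G` off `L` lifts `Z` into a plane
      have hr2 : M.eRk (Z : Set α) = 2 := le_antisymm h2 (two_le_eRk_of_two_le_card hs hG hZ (by omega))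
      obtain ⟨hL, hZL⟩ := clF_mem_lines (hZ.trans hG) hr2
      have hex : ∃ x ∈ G, x ∉ clF M Z := by
        by_contra hall
        push Not at hall
        have hsub : G ⊆ clF M Z := hall
        have := M.eRk_mono (Finset.coe_subset.2 hsub)
        rw [hr, (mem_lines.1 hL).2.2] at this
        exact absurd this (by decide)
      obtain ⟨x, hxG, hxL⟩ := hex
      have hr3 := eRk_insert_eq_three hs hL hZL (by omega) (hG hxG) hxL
      obtain ⟨hP, hZP⟩ := clF_mem_planes (Finset.insert_subset (hG hxG) (hZ.trans hG)) hr3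
      have hsub : Z ⊆ clF M (insert x Z) ∩ G :=
        Finset.subset_inter ((Finset.subset_insert x Z).trans hZP) hZ
      exact (Finset.card_le_card hsub).trans (hpl _ hP)
  · have hr3 : M.eRk (Z : Set α) = 3 := eRk_eq_of_le_of_not_le (n := 2) h3 h2
    obtain ⟨hP, hZP⟩ := clF_mem_planes (hZ.trans hG) hr3
    exact (Finset.card_le_card (Finset.subset_inter hZP hZ)).trans (hpl _ hP)

/-- `X = 0` when `g ≥ 15` and every plane trace has at most `7` points. -/
theorem Xcnt_eq_zero (hs : Simple M) (hG : G ⊆ gr M) (hr : M.eRk (G : Set α) = 4)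
    (hpl : ∀ P ∈ planes M, (P ∩ G).card ≤ 7) (h15 : 15 ≤ G.card) : Xcnt M G = 0 := by
  unfold Xcnt
  rw [Finset.card_eq_zero, Finset.filter_false_of_mem]
  rintro Z hZ ⟨hZ3, hZc⟩
  rw [Finset.mem_powerset] at hZ
  have h1 := card_le_seven_of_eRk_le_three hs hG hr hpl hZ hZ3
  have h2 := card_le_seven_of_eRk_le_three hs hG hr hpl Finset.sdiff_subset hZc
  have h3 := Finset.card_sdiff_add_card_eq_card hZ
  omega

/-! ## The per-plane bounds -/

/-- `cost_g(ρ) ≤ (g − 22/5)·D₃(ρ)` for every plane. -/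
theorem cost_le {P : Finset α} :
    cost M G P ≤ ((G.card : ℚ) - 22 / 5) * (D3 M G P : ℚ) := by
  unfold cost
  have hD : (0 : ℚ) ≤ D3 M G P := Nat.cast_nonneg _
  have hr : (0 : ℚ) ≤ r34 M G P := Nat.cast_nonneg _
  by_cases h4 : 4 ≤ (P ∩ G).card
  · have h4' : (4 : ℚ) ≤ (P ∩ G).card := by exact_mod_cast h4
    nlinarith
  · have hD0 : D3 M G P = 0 := by
      unfold D3
      rw [Finset.card_eq_zero, Finset.filter_false_of_mem]
      rintro S hS ⟨hc, -⟩
      have := Finset.card_le_card (Finset.mem_powerset.1 hS)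
      omega
    have hr0 : r34 M G P = 0 := by
      unfold r34
      rw [Finset.card_eq_zero, Finset.filter_false_of_mem]
      intro S hS
      have := Finset.card_le_card (Finset.mem_powersetCard.1 hS).1
      rw [(Finset.mem_powersetCard.1 hS).2] at this
      omega
    rw [hD0, hr0]
    norm_num

/-- `5·D₃(ρ) ≤ 14·t(ρ)` for every plane whose trace has at most `7` points (the trace of rank `≤ 2` has `D₃ = 0`). -/
theorem five_D3_le (hs : Simple M) (hG : G ⊆ gr M) {P : Finset α} (hP : P ∈ planes M) (h7 : (P ∩ G).card ≤ 7) :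
    5 * D3 M G P ≤ 14 * (indepTriples M (P ∩ G)).card := by
  by_cases hr : M.eRk ((P ∩ G : Finset α) : Set α) = 3
  · exact five_D3_le_fourteen_t hs hG h7 hr
  · have hle : M.eRk ((P ∩ G : Finset α) : Set α) ≤ 3 := by
      rw [← (mem_planes.1 hP).2.2]
      exact M.eRk_mono (Finset.coe_subset.2 Finset.inter_subset_left)
    have hle2 : M.eRk ((P ∩ G : Finset α) : Set α) ≤ 2 := by
      by_contra h
      exact hr (eRk_eq_of_le_of_not_le (n := 2) hle h)
    have hD0 : D3 M G P = 0 := by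
      unfold D3
      rw [Finset.card_eq_zero, Finset.filter_false_of_mem]
      rintro S hS ⟨-, hS3⟩
      have := M.eRk_mono (Finset.coe_subset.2 (Finset.mem_powerset.1 hS))
      rw [hS3] at this
      have := this.trans hle2
      exact absurd this (by decide)
    rw [hD0]
    exact Nat.zero_le _

/-- The independent triples of the plane traces are disjoint subfamilies of the independent triples of `G`:
`Σ_ρ t(ρ) ≤ C(g, 3)`. -/
theorem sum_card_indepTriples_le (hG : G ⊆ gr M) :
    ∑ P ∈ planes M, (indepTriples M (P ∩ G)).card ≤ G.card.choose 3 := by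
  have hmaps : ∀ T ∈ indepTriples M G, clF M T ∈ planes M := by
    intro T hT
    obtain ⟨hTG, -, hr⟩ := mem_indepTriples.1 hT
    exact (clF_mem_planes (hTG.trans hG) hr).1
  calc ∑ P ∈ planes M, (indepTriples M (P ∩ G)).card
      ≤ ∑ P ∈ planes M, ((indepTriples M G).filter (fun T : Finset α => clF M T = P)).card :=
        Finset.sum_le_sum (fun P hP => Finset.card_le_card (indepTriples_trace_subset_fiber hP))
    _ = (indepTriples M G).card := (Finset.card_eq_sum_card_fiberwise hmaps).symm
    _ ≤ (G.powersetCard 3).card := Finset.card_filter_le _ _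
    _ = G.card.choose 3 := Finset.card_powersetCard 3 G

/-! ## The numeric tail `H(g) > 0` -/

/-- `g^4 ≤ 2^g` for `g ≥ 16`. -/
theorem pow_four_le_two_pow {g : ℕ} (hg : 16 ≤ g) : g ^ 4 ≤ 2 ^ g := by
  induction g, hg using Nat.le_induction with
  | base => decide
  | succ n hn ih =>
    have h1 : 16 * n ^ 3 ≤ n ^ 4 := by
      calc 16 * n ^ 3 ≤ n * n ^ 3 := Nat.mul_le_mul_right _ hn
        _ = n ^ 4 := by ring
    have h2 : n ^ 2 ≤ n ^ 3 := Nat.pow_le_pow_right (by omega) (by norm_num)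
    have h3 : n ≤ n ^ 3 := by
      calc n = n ^ 1 := (pow_one n).symm
        _ ≤ n ^ 3 := Nat.pow_le_pow_right (by omega) (by norm_num)
    have h4 : 1 ≤ n ^ 3 := Nat.one_le_pow _ _ (by omega)
    have h5 : (n + 1) ^ 4 ≤ 2 * n ^ 4 := by nlinarith [h1, h2, h3, h4]
    calc (n + 1) ^ 4 ≤ 2 * n ^ 4 := h5
      _ ≤ 2 * 2 ^ n := by omega
      _ = 2 ^ (n + 1) := by ring

/-- `H(g) := F(g) − (14/5)(g − 22/5)·C(g,3) > 0` for every `g ≥ 15`. -/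
theorem H_pos {g : ℕ} (hg : 15 ≤ g) :
    14 / 5 * ((g : ℚ) - 22 / 5) * (g.choose 3 : ℚ) < Fg g := by
  unfold Fg
  rcases Nat.eq_or_lt_of_le hg with h15 | h16
  · subst h15
    have hc3 : Nat.choose 15 3 = 455 := by decide
    have hc4 : Nat.choose 15 4 = 1365 := by decide
    have hS : S3 15 = 576 := by decide
    rw [hc3, hc4, hS]
    norm_num
  · have h16' : 16 ≤ g := h16
    have hS : (0 : ℚ) ≤ S3 g := Nat.cast_nonneg _
    have h4 : (g.choose 4 : ℚ) ≤ (g : ℚ) ^ 4 / 24 := by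
      have := Nat.choose_le_pow_div (α := ℚ) 4 g
      have hf : ((4 : ℕ).factorial : ℚ) = 24 := by decide
      rwa [hf] at this
    have h3 : (g.choose 3 : ℚ) ≤ (g : ℚ) ^ 3 / 6 := by
      have := Nat.choose_le_pow_div (α := ℚ) 3 g
      have hf : ((3 : ℕ).factorial : ℚ) = 6 := by decide
      rwa [hf] at this
    have hpow : (g : ℚ) ^ 4 ≤ (2 : ℚ) ^ g := by exact_mod_cast pow_four_le_two_pow h16'
    have hg' : (16 : ℚ) ≤ g := by exact_mod_cast h16'
    have hgpos : (0 : ℚ) < g := by linarith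
    have hg3 : (0 : ℚ) ≤ (g : ℚ) ^ 3 := by positivity
    have hg4 : (0 : ℚ) < (g : ℚ) ^ 4 := by positivity
    -- `(14/5)(g − 22/5)·C(g,3) ≤ (14/5)·g·g^3/6 = (7/15)·g^4`, `(8/5)·C(g,4) ≤ g^4/15`
    have hA : 14 / 5 * ((g : ℚ) - 22 / 5) * (g.choose 3 : ℚ) ≤ 7 / 15 * (g : ℚ) ^ 4 := by
      have hch : (0 : ℚ) ≤ g.choose 3 := Nat.cast_nonneg _
      calc 14 / 5 * ((g : ℚ) - 22 / 5) * (g.choose 3 : ℚ) ≤ 14 / 5 * (g : ℚ) * (g.choose 3 : ℚ) := by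
            apply mul_le_mul_of_nonneg_right _ hch
            linarith
        _ ≤ 14 / 5 * (g : ℚ) * ((g : ℚ) ^ 3 / 6) := by
            apply mul_le_mul_of_nonneg_left h3
            linarith
        _ = 7 / 15 * (g : ℚ) ^ 4 := by ring
    nlinarith

/-! ## §22.7 -/

/-- **§22.7**: `J₄(G) > 0` for every rank-`4` set `G ⊆ E` of a simple matroid with `g ≥ 15` points and every plane
trace of at most `7` points. -/
theorem J_four_pos_of_fifteen_le (hs : Simple M) (hG : G ⊆ gr M) (hr : M.eRk (G : Set α) = 4)
    (hpl : ∀ P ∈ planes M, (P ∩ G).card ≤ 7) (h15 : 15 ≤ G.card) : 0 < J M G 4 := by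
  rw [J_four_identity hs hG hr, Xcnt_eq_zero hs hG hr hpl h15]
  have hg : (15 : ℚ) ≤ G.card := by exact_mod_cast h15
  -- the cost sum
  have hcost : ∑ P ∈ planes M, cost M G P ≤ ((G.card : ℚ) - 22 / 5) * ∑ P ∈ planes M, (D3 M G P : ℚ) := by
    rw [Finset.mul_sum]
    exact Finset.sum_le_sum (fun P _ => cost_le)
  have hD3 : ∑ P ∈ planes M, (D3 M G P : ℚ) ≤ 14 / 5 * ∑ P ∈ planes M, ((indepTriples M (P ∩ G)).card : ℚ) := by
    rw [Finset.mul_sum]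
    refine Finset.sum_le_sum (fun P hP => ?_)
    have := five_D3_le hs hG hP (hpl P hP)
    have h' : (5 : ℚ) * D3 M G P ≤ 14 * ((indepTriples M (P ∩ G)).card : ℚ) := by exact_mod_cast this
    linarith
  have ht : ∑ P ∈ planes M, ((indepTriples M (P ∩ G)).card : ℚ) ≤ (G.card.choose 3 : ℚ) := by
    have := sum_card_indepTriples_le (M := M) hG
    exact_mod_cast this
  have hbonus : 0 ≤ ∑ L ∈ lines M, bonus (L ∩ G).card :=
    Finset.sum_nonneg (fun L _ => by unfold bonus; positivity)
  have hlpp : (0 : ℚ) ≤ lpp M G := Nat.cast_nonneg _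
  have hH := H_pos h15
  have hg' : (0 : ℚ) ≤ (G.card : ℚ) - 22 / 5 := by linarith
  have h1 : ((G.card : ℚ) - 22 / 5) * ∑ P ∈ planes M, (D3 M G P : ℚ) ≤
      ((G.card : ℚ) - 22 / 5) * (14 / 5 * (G.card.choose 3 : ℚ)) := by
    apply mul_le_mul_of_nonneg_left _ hg'
    linarith
  push_cast
  nlinarith

end PercRepro.SixFour
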